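import Summits.CriticalPhenomena.PercolationContinuityZ3.Theorems.PercNearOneGluingNoHeavyLowerTailKnQuestion8CoefficientwiseQmixRootEdgeNoCore
import Summits.CriticalPhenomena.PercolationContinuityZ3.Theorems.PercNearOneGluingNoHeavyLowerTailKnQuestion8CoefficientwiseQmixRootEdgeSmallWall
import Summits.CriticalPhenomena.PercolationContinuityZ3.Theorems.PercNearOneGluingNoHeavyLowerTailKnQuestion8CoefficientwiseQmixRootEdgeLeafWall
import HarnessLib

/-!
# The two-point exclusion at a point with a ROOT EDGE, part 5: the point row when both wall vertices are LOCAL (adjacent to the root, small, or a leaf at the other) — prim-lf-2 gen 51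

Support file (`--supports stmt-CriticalPhenomena-4575`, closed), prover `prim-lf-2` (gen 51).  No definitions, no named facts, no sorries; standard axioms.
Memo `prim-lf-2/CW-ROOTEDGE-gen51.md` §3; parts 1–4 and 2b/2c: `…QmixRootEdgeClasses/Wall/Main/NoCore/SmallWall/LeafWall.lean`.

Setting: finite multigraph `ends : ι → Sym2 V`, root `x`, `K(s) = openCluster (ends '' s) x`; a point `u ∉ {x,p,q}` with exactly the edges `i_p = up`, `i_q = uq`, `i_x = ux`.  By part 3,
`Q_mix(p,q)[1_u, 1_w] ≥ WC(p)[1_w] + WC(q)[1_w]` (two ROOT-DOM wall sums on `G − u`); each wall sum is `≥ 0` as soon as its wall vertex `z ∈ {p,q}` (with 'source' `s` = the other one) is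
LOCAL: adjacent to the root (`wallClass_eq_zero_of_adj_root`), or SMALL — its only edges besides `uz` go to `s` and to `w`, one each (`wallClass_pointIndicator_nonneg_of_smallWall`) — or a LEAF
at `s` (`wallClass_nonneg_of_leafWall`).
* `qmix_rootEdge_pointIndicator_nonneg_of_localWalls` — `Q_mix(p,q)[1_u, 1_w] ≥ 0` when both `p` and `q` are local in this sense;
* `noCore_rootEdge_pointIndicator_nonneg_of_localWalls` — with gen 48's degree-two reduction: NO-CORE(y)[1_u, 1_w] ≥ 0 for `deg y = 2`, `N(y) = {p,q}`, `N(u) = {p,q,x}` and `p, q` local in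
  `G − y − u`.  At 6 vertices `G − y − u` has vertex set `{x, w, p, q}`, so this settles EVERY residual `(G, y)` of prim-lf-2 gen 50 in which one point has `N = {x,p,q}` (78 of 108; the
  other 30 have both points of degree two between `x` and `N(y)`; prim-lf-2 code/gen51/nccov51.c).
[cite: KozmaNitzan2024, Questions 8–9 (§5.5 p. 36) (context: the Question-8 pocket covariance programme)]
-/

namespace Summit.CriticalPhenomena.PercolationContinuityZ3.Theorems

open Finset Literature.Probability.Percolation

namespace Coefficientwise

variable {ι V : Type*} [Fintype ι] [DecidableEq ι] (ends : ι → Sym2 V) (x : V)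

section localWalls

variable {u p q w : V} {i_p i_q i_x : ι}

open Classical in
/-- **THEOREM (points): `Q_mix(p,q)[1_u, 1_w] ≥ 0` at a degree-three point adjacent to the root when both `p` and `q` are local.**  Let `u ∉ {x,p,q,w}` have exactly the edges `i_p = up`,
`i_q = uq`, `i_x = ux` (`p, q, x, w` distinct as needed).  Suppose that `p` is adjacent to `x`, OR the only edges at `p` are `i_p`, one edge to `q` and one edge to `w`, OR the only edges at `p`
are `i_p` and one edge to `q`; and the same for `q` (with `p` in place of `q`).  Then `0 ≤ Σ_{s : ¬(p ∈ K s ∧ q ∈ K sᶜ)} ([u ∈ K s] − [u ∈ K sᶜ])·([w ∈ K s] − [w ∈ K sᶜ])`.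
[cite: KozmaNitzan2024, Questions 8–9 (§5.5 p. 36) (context)] -/
theorem qmix_rootEdge_pointIndicator_nonneg_of_localWalls (hi_p : ends i_p = s(u, p)) (hi_q : ends i_q = s(u, q)) (hi_x : ends i_x = s(u, x))
    (hpq : i_p ≠ i_q) (hpx : i_p ≠ i_x) (hqx : i_q ≠ i_x)
    (hdeg : ∀ i, u ∈ ends i → i = i_p ∨ i = i_q ∨ i = i_x) (hpu : p ≠ u) (hqu : q ≠ u) (hxu : x ≠ u) (hwu : w ≠ u)
    (hxp : x ≠ p) (hxq : x ≠ q) (hqp : q ≠ p) (hwp : w ≠ p) (hwq : w ≠ q)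
    (hp : (∃ k, ends k = s(p, x)) ∨
      (∃ e₁ e₂, e₁ ≠ e₂ ∧ ends e₁ = s(p, q) ∧ ends e₂ = s(p, w) ∧ ∀ i, p ∈ ends i → i = i_p ∨ i = e₁ ∨ i = e₂) ∨
      (∃ e₁, ends e₁ = s(p, q) ∧ ∀ i, p ∈ ends i → i = i_p ∨ i = e₁))
    (hq : (∃ k, ends k = s(q, x)) ∨
      (∃ e₁ e₂, e₁ ≠ e₂ ∧ ends e₁ = s(q, p) ∧ ends e₂ = s(q, w) ∧ ∀ i, q ∈ ends i → i = i_q ∨ i = e₁ ∨ i = e₂) ∨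
      (∃ e₁, ends e₁ = s(q, p) ∧ ∀ i, q ∈ ends i → i = i_q ∨ i = e₁)) :
    0 ≤ ∑ s ∈ univ.filter (fun s : Finset ι => ¬ (p ∈ openCluster (ends '' (↑s : Set ι)) x ∧ q ∈ openCluster (ends '' (↑(sᶜ) : Set ι)) x)),
      ((if u ∈ openCluster (ends '' (↑s : Set ι)) x then (1 : ℝ) else 0) - (if u ∈ openCluster (ends '' (↑(sᶜ) : Set ι)) x then (1 : ℝ) else 0)) *
        ((if w ∈ openCluster (ends '' (↑s : Set ι)) x then (1 : ℝ) else 0) - (if w ∈ openCluster (ends '' (↑(sᶜ) : Set ι)) x then (1 : ℝ) else 0)) := by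
  have hgm : Monotone (fun C : Set V => if w ∈ C then (1 : ℝ) else 0) := fun A B hAB => by
    by_cases hA : w ∈ A
    · simp [hA, hAB hA]
    · simp only [hA, if_false]; split_ifs <;> norm_num
  have hD : ∀ i ∈ ({i_p, i_q, i_x} : Finset ι), u ∈ ends i := by
    intro i hi
    rcases Finset.mem_insert.mp hi with rfl | hi
    · rw [hi_p]; exact Sym2.mem_mk_left _ _
    · rcases Finset.mem_insert.mp hi with rfl | hi
      · rw [hi_q]; exact Sym2.mem_mk_left _ _
      · rw [Finset.mem_singleton.mp hi, hi_x]; exact Sym2.mem_mk_left _ _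
  have hdeg' : ∀ i, u ∈ ends i → i ∈ ({i_p, i_q, i_x} : Finset ι) := by
    intro i hi
    rcases hdeg i hi with rfl | rfl | rfl <;> simp
  have hi_pD : i_p ∈ ({i_p, i_q, i_x} : Finset ι) := by simp
  have hi_qD : i_q ∈ ({i_p, i_q, i_x} : Finset ι) := by simp
  have hi_xD : i_x ∈ ({i_p, i_q, i_x} : Finset ι) := by simp
  -- class data for the wall sum at `p` (red edges `{i_q, i_x}`, blue `{i_p}`)
  have hRends : ∀ i ∈ ({i_q, i_x} : Finset ι), ends i = s(u, x) ∨ ends i = s(u, q) := by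
    intro i hi
    rcases Finset.mem_insert.mp hi with rfl | hi
    · exact Or.inr hi_q
    · rw [Finset.mem_singleton.mp hi]; exact Or.inl hi_x
  have hP : ∀ i ∈ ({i_p, i_q, i_x} : Finset ι) \ {i_q, i_x}, ends i = s(u, p) := by
    intro i hi
    rw [Finset.mem_sdiff] at hi
    rcases Finset.mem_insert.mp hi.1 with rfl | hi'
    · exact hi_p
    · exact absurd hi' hi.2
  -- class data for the wall sum at `q` (red edges `{i_p, i_x} = D ∖ {i_q}`, blue `{i_q}`)
  have hRends' : ∀ i ∈ ({i_p, i_q, i_x} : Finset ι) \ {i_q}, ends i = s(u, x) ∨ ends i = s(u, p) := by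
    intro i hi
    rw [Finset.mem_sdiff, Finset.mem_singleton] at hi
    rcases Finset.mem_insert.mp hi.1 with rfl | hi'
    · exact Or.inr hi_p
    · rcases Finset.mem_insert.mp hi' with rfl | hi'
      · exact absurd rfl hi.2
      · rw [Finset.mem_singleton.mp hi']; exact Or.inl hi_x
  have hsub : ({i_q} : Finset ι) ⊆ ({i_p, i_q, i_x} : Finset ι) := by
    intro a ha; rw [Finset.mem_singleton.mp ha]; simp
  have hDD : ({i_p, i_q, i_x} : Finset ι) \ (({i_p, i_q, i_x} : Finset ι) \ {i_q}) = {i_q} := Finset.sdiff_sdiff_eq_self hsub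
  have hP' : ∀ i ∈ ({i_p, i_q, i_x} : Finset ι) \ (({i_p, i_q, i_x} : Finset ι) \ {i_q}), ends i = s(u, q) := by
    intro i hi; rw [hDD, Finset.mem_singleton] at hi; rw [hi]; exact hi_q
  have hxR' : i_x ∈ ({i_p, i_q, i_x} : Finset ι) \ {i_q} := Finset.mem_sdiff.mpr ⟨hi_xD, by rw [Finset.mem_singleton]; exact fun h => hqx h.symm⟩
  have hpR' : i_p ∈ ({i_p, i_q, i_x} : Finset ι) \ {i_q} := Finset.mem_sdiff.mpr ⟨hi_pD, by rw [Finset.mem_singleton]; exact hpq⟩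
  -- the wall sum at p
  have hWp : 0 ≤ ∑ r : Finset {j : ι // j ∉ ({i_p, i_q, i_x} : Finset ι)},
      (if (p ∉ openCluster (ends '' (↑(r.map (Function.Embedding.subtype _) ∪ ({i_q, i_x} : Finset ι)) : Set ι)) x ∧
            p ∉ openCluster (ends '' (↑(rᶜ.map (Function.Embedding.subtype _) ∪ (({i_p, i_q, i_x} : Finset ι) \ {i_q, i_x})) : Set ι)) x) then
        ((if w ∈ openCluster (ends '' (↑(r.map (Function.Embedding.subtype _) ∪ ({i_q, i_x} : Finset ι)) : Set ι)) x then (1 : ℝ) else 0) -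
          (if w ∈ openCluster (ends '' (↑(rᶜ.map (Function.Embedding.subtype _) ∪ (({i_p, i_q, i_x} : Finset ι) \ {i_q, i_x})) : Set ι)) x then (1 : ℝ) else 0))
      else 0) := by
    rcases hp with ⟨k, hk⟩ | ⟨e₁, e₂, hne, he₁, he₂, hN⟩ | ⟨e₁, he₁, hN⟩
    · exact le_of_eq (wallClass_eq_zero_of_adj_root ends x ({i_p, i_q, i_x} : Finset ι) {i_q, i_x} hD hk hpu hxu hxp _).symm
    · refine wallClass_pointIndicator_nonneg_of_smallWall ends x ({i_p, i_q, i_x} : Finset ι) {i_q, i_x} hdeg' hD hi_x (by simp) hxu hi_q (by simp) hqu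
        hRends hP hpu he₁ he₂ hne ?_ hwu hxp hqp hwp
      intro i hiD hpi
      rcases hN i hpi with rfl | h | h
      · exact absurd hi_pD hiD
      · exact Or.inl h
      · exact Or.inr h
    · refine wallClass_nonneg_of_leafWall ends x ({i_p, i_q, i_x} : Finset ι) {i_q, i_x} hdeg' hD hi_x (by simp) hxu hi_q (by simp) hqu
        hRends hP hpu he₁ ?_ hxp hqp (fun C : Set V => if w ∈ C then (1 : ℝ) else 0) hgm
      intro i hiD hpi
      rcases hN i hpi with rfl | h
      · exact absurd hi_pD hiD
      · exact h
  -- the wall sum at q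
  have hWq : 0 ≤ ∑ r : Finset {j : ι // j ∉ ({i_p, i_q, i_x} : Finset ι)},
      (if (q ∉ openCluster (ends '' (↑(r.map (Function.Embedding.subtype _) ∪ (({i_p, i_q, i_x} : Finset ι) \ {i_q})) : Set ι)) x ∧
            q ∉ openCluster (ends '' (↑(rᶜ.map (Function.Embedding.subtype _) ∪ ({i_q} : Finset ι)) : Set ι)) x) then
        ((if w ∈ openCluster (ends '' (↑(r.map (Function.Embedding.subtype _) ∪ (({i_p, i_q, i_x} : Finset ι) \ {i_q})) : Set ι)) x then (1 : ℝ) else 0) -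
          (if w ∈ openCluster (ends '' (↑(rᶜ.map (Function.Embedding.subtype _) ∪ ({i_q} : Finset ι)) : Set ι)) x then (1 : ℝ) else 0))
      else 0) := by
    rcases hq with ⟨k, hk⟩ | ⟨e₁, e₂, hne, he₁, he₂, hN⟩ | ⟨e₁, he₁, hN⟩
    · have h0 := wallClass_eq_zero_of_adj_root ends x ({i_p, i_q, i_x} : Finset ι) (({i_p, i_q, i_x} : Finset ι) \ {i_q}) hD hk hqu hxu hxq
        (fun r => (if w ∈ openCluster (ends '' (↑(r.map (Function.Embedding.subtype _) ∪ (({i_p, i_q, i_x} : Finset ι) \ {i_q})) : Set ι)) x then (1 : ℝ) else 0) -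
          (if w ∈ openCluster (ends '' (↑(rᶜ.map (Function.Embedding.subtype _) ∪ (({i_p, i_q, i_x} : Finset ι) \ (({i_p, i_q, i_x} : Finset ι) \ {i_q}))) : Set ι)) x
            then (1 : ℝ) else 0))
      rw [hDD] at h0
      exact le_of_eq h0.symm
    · have h1 := wallClass_pointIndicator_nonneg_of_smallWall ends x ({i_p, i_q, i_x} : Finset ι) (({i_p, i_q, i_x} : Finset ι) \ {i_q}) hdeg' hD hi_x hxR' hxu
        hi_p hpR' hpu hRends' hP' hqu he₁ he₂ hne ?_ hwu hxq (fun h => hqp h.symm) hwq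
      · rw [hDD] at h1; exact h1
      · intro i hiD hqi
        rcases hN i hqi with rfl | h | h
        · exact absurd hi_qD hiD
        · exact Or.inl h
        · exact Or.inr h
    · have h1 := wallClass_nonneg_of_leafWall ends x ({i_p, i_q, i_x} : Finset ι) (({i_p, i_q, i_x} : Finset ι) \ {i_q}) hdeg' hD hi_x hxR' hxu
        hi_p hpR' hpu hRends' hP' hqu he₁ ?_ hxq (fun h => hqp h.symm) (fun C : Set V => if w ∈ C then (1 : ℝ) else 0) hgm
      · rw [hDD] at h1; exact h1
      · intro i hiD hqi
        rcases hN i hqi with rfl | h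
        · exact absurd hi_qD hiD
        · exact h
  exact qmix_rootEdge_nonneg_of_wallClasses ends x hi_p hi_q hi_x hpq hpx hqx hdeg hpu hqu hxu
    (fun C : Set V => if w ∈ C then (1 : ℝ) else 0) hgm hWp hWq

end localWalls

section localWallsNoCore

variable {y u p q w : V} {j₁ j₂ i_p i_q i_x : ι}

open Classical in
/-- **COROLLARY (the 6-vertex residue shape `N(u) = {p,q,x}`, local case): NO-CORE(y)[1_u, 1_w] ≥ 0.**  Let `y ∉ {x,p,q,u,w}` have exactly the edges `j₁ = yp`, `j₂ = yq`, let
`u ∉ {x,p,q,w}` have exactly the edges `i_p = up`, `i_q = uq`, `i_x = ux`, and let each of `p`, `q` be LOCAL in `G − y − u`: adjacent to `x`, or with exactly one edge to the other one and one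
to `w` as its only further edges, or with one edge to the other one as its only further edge.  Then `0 ≤ Σ_{s : ¬(y ∈ K s ∧ y ∈ K sᶜ)} ([u∈K s] − [u∈K sᶜ])([w∈K s] − [w∈K sᶜ])`.  At 6 vertices
this is every residual `(G, y)` of gen 50 with a point of neighbourhood `{x, p, q}` (78 of 108).  [cite: KozmaNitzan2024, Questions 8–9 (§5.5 p. 36) (context)] -/
theorem noCore_rootEdge_pointIndicator_nonneg_of_localWalls (hj₁ : ends j₁ = s(y, p)) (hj₂ : ends j₂ = s(y, q)) (hjne : j₁ ≠ j₂)
    (hdegy : ∀ i, y ∈ ends i → i = j₁ ∨ i = j₂)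
    (hi_p : ends i_p = s(u, p)) (hi_q : ends i_q = s(u, q)) (hi_x : ends i_x = s(u, x))
    (hpq : i_p ≠ i_q) (hpx : i_p ≠ i_x) (hqx : i_q ≠ i_x)
    (hdegu : ∀ i, u ∈ ends i → i = i_p ∨ i = i_q ∨ i = i_x)
    (hpy : p ≠ y) (hqy : q ≠ y) (hxy : x ≠ y) (hpu : p ≠ u) (hqu : q ≠ u) (hxu : x ≠ u) (hyu : y ≠ u) (hwu : w ≠ u) (hwy : w ≠ y)
    (hxp : x ≠ p) (hxq : x ≠ q) (hqp : q ≠ p) (hwp : w ≠ p) (hwq : w ≠ q)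
    (hp : (∃ k, ends k = s(p, x)) ∨
      (∃ e₁ e₂, e₁ ≠ e₂ ∧ ends e₁ = s(p, q) ∧ ends e₂ = s(p, w) ∧ ∀ i, p ∈ ends i → i = j₁ ∨ i = i_p ∨ i = e₁ ∨ i = e₂) ∨
      (∃ e₁, ends e₁ = s(p, q) ∧ ∀ i, p ∈ ends i → i = j₁ ∨ i = i_p ∨ i = e₁))
    (hq : (∃ k, ends k = s(q, x)) ∨
      (∃ e₁ e₂, e₁ ≠ e₂ ∧ ends e₁ = s(q, p) ∧ ends e₂ = s(q, w) ∧ ∀ i, q ∈ ends i → i = j₂ ∨ i = i_q ∨ i = e₁ ∨ i = e₂) ∨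
      (∃ e₁, ends e₁ = s(q, p) ∧ ∀ i, q ∈ ends i → i = j₂ ∨ i = i_q ∨ i = e₁)) :
    0 ≤ ∑ s ∈ univ.filter (fun s : Finset ι =>
        ¬ (y ∈ openCluster (ends '' (↑s : Set ι)) x ∧ y ∈ openCluster (ends '' (↑(sᶜ) : Set ι)) x)),
      ((if u ∈ openCluster (ends '' (↑s : Set ι)) x then (1 : ℝ) else 0) - (if u ∈ openCluster (ends '' (↑(sᶜ) : Set ι)) x then (1 : ℝ) else 0)) *
        ((if w ∈ openCluster (ends '' (↑s : Set ι)) x then (1 : ℝ) else 0) - (if w ∈ openCluster (ends '' (↑(sᶜ) : Set ι)) x then (1 : ℝ) else 0)) := by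
  have havoid : ∀ {i : ι} {a b : V}, ends i = s(a, b) → a ≠ y → b ≠ y → i ≠ j₁ ∧ i ≠ j₂ := by
    intro i a b hi hay hby
    have hyi : y ∉ ends i := by
      rw [hi, Sym2.mem_iff]; rintro (h | h); exact hay h.symm; exact hby h.symm
    constructor
    · rintro rfl; apply hyi; rw [hj₁]; exact Sym2.mem_mk_left _ _
    · rintro rfl; apply hyi; rw [hj₂]; exact Sym2.mem_mk_left _ _
  have hi_pne := havoid hi_p hyu.symm hpy
  have hi_qne := havoid hi_q hyu.symm hqy
  have hi_xne := havoid hi_x hyu.symm hxy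
  set ends' : {j : ι // j ≠ j₁ ∧ j ≠ j₂} → Sym2 V := fun j => ends j.1 with hends'
  have hi_p' : ends' ⟨i_p, hi_pne⟩ = s(u, p) := hi_p
  have hi_q' : ends' ⟨i_q, hi_qne⟩ = s(u, q) := hi_q
  have hi_x' : ends' ⟨i_x, hi_xne⟩ = s(u, x) := hi_x
  have hpq' : (⟨i_p, hi_pne⟩ : {j : ι // j ≠ j₁ ∧ j ≠ j₂}) ≠ ⟨i_q, hi_qne⟩ := fun h => hpq (congrArg Subtype.val h)
  have hpx' : (⟨i_p, hi_pne⟩ : {j : ι // j ≠ j₁ ∧ j ≠ j₂}) ≠ ⟨i_x, hi_xne⟩ := fun h => hpx (congrArg Subtype.val h)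
  have hqx' : (⟨i_q, hi_qne⟩ : {j : ι // j ≠ j₁ ∧ j ≠ j₂}) ≠ ⟨i_x, hi_xne⟩ := fun h => hqx (congrArg Subtype.val h)
  have hdegu' : ∀ i : {j : ι // j ≠ j₁ ∧ j ≠ j₂}, u ∈ ends' i → i = ⟨i_p, hi_pne⟩ ∨ i = ⟨i_q, hi_qne⟩ ∨ i = ⟨i_x, hi_xne⟩ := by
    intro i hi
    rcases hdegu i.1 hi with h | h | h
    · exact Or.inl (Subtype.ext h)
    · exact Or.inr (Or.inl (Subtype.ext h))
    · exact Or.inr (Or.inr (Subtype.ext h))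
  -- transporting the locality hypotheses to `G − y` (the edge `j₁` resp. `j₂` disappears)
  have hp' : (∃ k, ends' k = s(p, x)) ∨
      (∃ e₁ e₂, e₁ ≠ e₂ ∧ ends' e₁ = s(p, q) ∧ ends' e₂ = s(p, w) ∧ ∀ i, p ∈ ends' i → i = ⟨i_p, hi_pne⟩ ∨ i = e₁ ∨ i = e₂) ∨
      (∃ e₁, ends' e₁ = s(p, q) ∧ ∀ i, p ∈ ends' i → i = ⟨i_p, hi_pne⟩ ∨ i = e₁) := by
    rcases hp with ⟨k, hk⟩ | ⟨e₁, e₂, hne, he₁, he₂, hN⟩ | ⟨e₁, he₁, hN⟩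
    · exact Or.inl ⟨⟨k, havoid hk hpy hxy⟩, hk⟩
    · refine Or.inr (Or.inl ⟨⟨e₁, havoid he₁ hpy hqy⟩, ⟨e₂, havoid he₂ hpy hwy⟩, fun h => hne (congrArg Subtype.val h), he₁, he₂, ?_⟩)
      intro i hi
      rcases hN i.1 hi with h | h | h | h
      · exact absurd h i.2.1
      · exact Or.inl (Subtype.ext h)
      · exact Or.inr (Or.inl (Subtype.ext h))
      · exact Or.inr (Or.inr (Subtype.ext h))
    · refine Or.inr (Or.inr ⟨⟨e₁, havoid he₁ hpy hqy⟩, he₁, ?_⟩)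
      intro i hi
      rcases hN i.1 hi with h | h | h
      · exact absurd h i.2.1
      · exact Or.inl (Subtype.ext h)
      · exact Or.inr (Subtype.ext h)
  have hq' : (∃ k, ends' k = s(q, x)) ∨
      (∃ e₁ e₂, e₁ ≠ e₂ ∧ ends' e₁ = s(q, p) ∧ ends' e₂ = s(q, w) ∧ ∀ i, q ∈ ends' i → i = ⟨i_q, hi_qne⟩ ∨ i = e₁ ∨ i = e₂) ∨
      (∃ e₁, ends' e₁ = s(q, p) ∧ ∀ i, q ∈ ends' i → i = ⟨i_q, hi_qne⟩ ∨ i = e₁) := by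
    rcases hq with ⟨k, hk⟩ | ⟨e₁, e₂, hne, he₁, he₂, hN⟩ | ⟨e₁, he₁, hN⟩
    · exact Or.inl ⟨⟨k, havoid hk hqy hxy⟩, hk⟩
    · refine Or.inr (Or.inl ⟨⟨e₁, havoid he₁ hqy hpy⟩, ⟨e₂, havoid he₂ hqy hwy⟩, fun h => hne (congrArg Subtype.val h), he₁, he₂, ?_⟩)
      intro i hi
      rcases hN i.1 hi with h | h | h | h
      · exact absurd h i.2.2
      · exact Or.inl (Subtype.ext h)
      · exact Or.inr (Or.inl (Subtype.ext h))
      · exact Or.inr (Or.inr (Subtype.ext h))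
    · refine Or.inr (Or.inr ⟨⟨e₁, havoid he₁ hqy hpy⟩, he₁, ?_⟩)
      intro i hi
      rcases hN i.1 hi with h | h | h
      · exact absurd h i.2.2
      · exact Or.inl (Subtype.ext h)
      · exact Or.inr (Subtype.ext h)
  -- the same data with the roles of p and q exchanged (for Q_mix(q,p))
  have hdegu'' : ∀ i : {j : ι // j ≠ j₁ ∧ j ≠ j₂}, u ∈ ends' i → i = ⟨i_q, hi_qne⟩ ∨ i = ⟨i_p, hi_pne⟩ ∨ i = ⟨i_x, hi_xne⟩ := by
    intro i hi
    rcases hdegu' i hi with h | h | h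
    · exact Or.inr (Or.inl h)
    · exact Or.inl h
    · exact Or.inr (Or.inr h)
  have hfm : Monotone (fun C : Set V => if u ∈ C then (1 : ℝ) else 0) := fun A B hAB => by
    by_cases hA : u ∈ A
    · simp [hA, hAB hA]
    · simp only [hA, if_false]; split_ifs <;> norm_num
  have hgm : Monotone (fun C : Set V => if w ∈ C then (1 : ℝ) else 0) := fun A B hAB => by
    by_cases hA : w ∈ A
    · simp [hA, hAB hA]
    · simp only [hA, if_false]; split_ifs <;> norm_num
  have hfy : ∀ C : Set V, (fun C : Set V => if u ∈ C then (1 : ℝ) else 0) (insert y C) = (fun C : Set V => if u ∈ C then (1 : ℝ) else 0) C :=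
    fun C => by simp [Set.mem_insert_iff, hyu.symm]
  have hgy : ∀ C : Set V, (fun C : Set V => if w ∈ C then (1 : ℝ) else 0) (insert y C) = (fun C : Set V => if w ∈ C then (1 : ℝ) else 0) C :=
    fun C => by simp [Set.mem_insert_iff, hwy]
  have hQpq := qmix_rootEdge_pointIndicator_nonneg_of_localWalls ends' x hi_p' hi_q' hi_x' hpq' hpx' hqx' hdegu' hpu hqu hxu hwu hxp hxq hqp hwp hwq hp' hq'
  have hQqp := qmix_rootEdge_pointIndicator_nonneg_of_localWalls ends' x hi_q' hi_p' hi_x' hpq'.symm hqx' hpx' hdegu'' hqu hpu hxu hwu hxq hxp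
    (fun h => hqp h.symm) hwq hwp hq' hp'
  exact noCore_degTwo_nonneg_of_qmix ends x (fun C : Set V => if u ∈ C then (1 : ℝ) else 0) (fun C : Set V => if w ∈ C then (1 : ℝ) else 0)
    hj₁ hj₂ hjne hdegy hpy hqy hxy hfm hgm hfy hgy hQpq hQqp

end localWallsNoCore

end Coefficientwise

end Summit.CriticalPhenomena.PercolationContinuityZ3.Theorems
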